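import Summits.Ventures.CertifiedArithmetic.LowPrec.GemmThetaLawE2M1Defs

/-!
# The θ-certificate of E2M1² at every precision `p ≥ 9`: the potential on values and class coverage

HONEST FRAMING (venture CertifiedArithmetic / cell `pub-lowprec`, seat gemm, gen 12): certified error
envelopes and provably optimal rounding/accumulation schemes for low-precision formats under stated
cost models; every table by two implementations; no hardware or vendor claims.

Soundness, part 1, of the symbolic certificate `GemmThetaLawE2M1Defs.lean` (paper `gemm.tex`
§Regimes Thm t:thetap): the potential `ψ_p` as an integer function `psiZp m` of a signed quarter-unit
value (`m = p - 1` trailing bits, `H = 2^(m-1)`), the state set `stZ m` (`|V| < 2^p`, or a vertex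
`(M + t)·u_j`, `j ≤ 7`, `t ≤ M`, top `2^9 M` included as `j = 7, t = M`), the agreement of the
symbolic potential forms (`psiBig`, `Cls.psiF`, `psiTgt`) with `psiZp` at every parameter of the
domain — including the gluing of consecutive binades at `t = M` (`B_{j+1} = B_j + s_j/2`) — and the
COVERAGE of every state of magnitude `≥ 2^p` by a class at admissible parameters `(H, T)`.
-/

namespace Literature.ComputerArithmetic.FloatingPoint

namespace MiniFloat

namespace ThetaLawE2M1

open ThetaE2M1 (lamQ)
open ThetaLaw
open ThetaLaw.AForm (const smul)

/-! ### The potential and the state set on integer values -/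

/-- THE POTENTIAL `4ψ_p` at a signed quarter-unit value `V` (`m = p - 1`): `|V|` on the negative
side and on the exact region `V < 2^p`; on the vertex `(M + t)·u_j` of binade `j`
(`u_j = 2^(j+1)`, `M = 2^m`): `2B_j·H + s_j ⌈t/2⌉` for `j ≤ 6` (`H = M/2`), `42H + 32t` for
`j = 7`, `106 H` above. [gemm.tex Thm t:thetap (ii), transcribed] -/
def psiZp (m : ℕ) (V : ℤ) : ℤ :=
  if V < 0 then -V
  else if V < 2 ^ (m + 1) then V
  else
    let n := V.toNat
    let e := Nat.log2 n - m
    let t := n / 2 ^ e - 2 ^ m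
    if e ≤ 7 then bH (e - 1) * 2 ^ (m - 1) + sOdd (e - 1) * (((t + 1) / 2 : ℕ) : ℤ)
    else if e = 8 then 42 * 2 ^ (m - 1) + 32 * (t : ℤ)
    else 106 * 2 ^ (m - 1)

/-- THE STATE SET `S_p` in quarter units: `|V| < 2^p`, or `|V| = (M + t)·u_j` with `j ≤ 7`,
`t ≤ M` (`t = M` is the first vertex of the next binade; `j = 7, t = M` is the top `2^9 M`).
[gemm.tex Thm t:thetap (i)] -/
def stZ (m : ℕ) (V : ℤ) : Prop :=
  V.natAbs < 2 ^ (m + 1) ∨ ∃ j t : ℕ, j ≤ 7 ∧ t ≤ 2 ^ m ∧ V.natAbs = (2 ^ m + t) * 2 ^ (j + 1)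

/-- On the negative side the potential is the magnitude. [gemm.tex Thm t:thetap (ii)] -/
theorem psiZp_of_neg (m : ℕ) {V : ℤ} (h : V < 0) : psiZp m V = -V := by
  unfold psiZp; rw [if_pos h]

/-- On the exact region the potential is the value. [gemm.tex Thm t:thetap (ii)] -/
theorem psiZp_of_small (m : ℕ) {V : ℤ} (h0 : 0 ≤ V) (h : V < 2 ^ (m + 1)) : psiZp m V = V := by
  unfold psiZp; rw [if_neg (by omega), if_pos h]

/-- `ψ(V) = |V|` whenever `|V| < 2^p`. [gemm.tex Thm t:thetap (ii)] -/
theorem psiZp_of_natAbs_lt (m : ℕ) {V : ℤ} (h : V.natAbs < 2 ^ (m + 1)) :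
    psiZp m V = (V.natAbs : ℤ) := by
  have h' : ((V.natAbs : ℕ) : ℤ) < (2 : ℤ) ^ (m + 1) := by exact_mod_cast h
  by_cases hV : V < 0
  · rw [psiZp_of_neg m hV]; omega
  · rw [psiZp_of_small m (by omega) (by omega)]; omega

/-- `ψ(-W) = W` for `W ≥ 0`. [gemm.tex Thm t:thetap (ii)] -/
theorem psiZp_neg_of_nonneg (m : ℕ) {W : ℤ} (h : 0 ≤ W) : psiZp m (-W) = W := by
  rcases eq_or_lt_of_le h with rfl | h'
  · simp [psiZp]
  · rw [psiZp_of_neg m (by omega)]; ring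

/-- THE POTENTIAL AT A VERTEX `(M + t)·u_j`, `t < M`, `j ≤ 8`. [gemm.tex Thm t:thetap (ii)] -/
theorem psiZp_vertex {m : ℕ} {j t : ℕ} (ht : t < 2 ^ m) :
    psiZp m ((((2 ^ m + t) * 2 ^ (j + 1) : ℕ) : ℤ)) =
      if j ≤ 6 then bH j * 2 ^ (m - 1) + sOdd j * ((((t + 1) / 2 : ℕ)) : ℤ)
      else if j = 7 then 42 * 2 ^ (m - 1) + 32 * (t : ℤ) else 106 * 2 ^ (m - 1) := by
  have hn0 : (2 ^ m + t) * 2 ^ (j + 1) ≠ 0 := by positivity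
  have hlo : 2 ^ (m + j + 1) ≤ (2 ^ m + t) * 2 ^ (j + 1) := by
    rw [show m + j + 1 = m + (j + 1) by omega, pow_add]
    exact Nat.mul_le_mul_right _ (Nat.le_add_right _ _)
  have hhi : (2 ^ m + t) * 2 ^ (j + 1) < 2 ^ (m + j + 1 + 1) := by
    have h1 : 2 ^ m + t < 2 ^ (m + 1) := by rw [pow_succ]; omega
    calc (2 ^ m + t) * 2 ^ (j + 1) < 2 ^ (m + 1) * 2 ^ (j + 1) :=
          Nat.mul_lt_mul_of_pos_right h1 (by positivity)
      _ = 2 ^ (m + j + 1 + 1) := by rw [← pow_add, show m + 1 + (j + 1) = m + j + 1 + 1 by omega]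
  have hlog : Nat.log2 ((2 ^ m + t) * 2 ^ (j + 1)) = m + j + 1 := (Nat.log2_eq_iff hn0).mpr ⟨hlo, hhi⟩
  have hge : ¬ ((((2 ^ m + t) * 2 ^ (j + 1) : ℕ) : ℤ)) < 2 ^ (m + 1) := by
    rw [not_lt]
    have : 2 ^ (m + 1) ≤ (2 ^ m + t) * 2 ^ (j + 1) :=
      le_trans (Nat.pow_le_pow_right (by norm_num) (by omega)) hlo
    exact_mod_cast this
  have he : m + j + 1 - m = j + 1 := by omega
  unfold psiZp
  rw [if_neg (not_lt.mpr (by positivity)), if_neg hge]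
  simp only [Int.toNat_natCast, hlog, he, Nat.mul_div_cancel _ (show 0 < 2 ^ (j + 1) by positivity),
    Nat.add_sub_cancel_left, Nat.add_sub_cancel]
  by_cases h6 : j ≤ 6
  · rw [if_pos (by omega), if_pos h6]
  · rw [if_neg (by omega), if_neg h6]
    by_cases h7 : j = 7
    · rw [if_pos (by omega), if_pos h7]
    · rw [if_neg (by omega), if_neg h7]

/-- THE GLUING OF CONSECUTIVE BINADES: the closed form of binade `j` at `t = M` is the closed form of
binade `j + 1` at `t = 0` (`B_{j+1} = B_j + s_j/2`; `13 + 8 = 21`; `21 + 32 = 53`).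
[gemm.tex Thm t:thetap (ii)] -/
theorem psi_glue (j : ℕ) (hj : j ≤ 7) (Hh : ℤ) :
    (if j + 1 ≤ 6 then bH (j + 1) * Hh + sOdd (j + 1) * ((((0 + 1) / 2 : ℕ)) : ℤ)
      else if j + 1 = 7 then 42 * Hh + 32 * ((0 : ℕ) : ℤ) else 106 * Hh) =
    (if j ≤ 6 then bH j * Hh + sOdd j * Hh else if j = 7 then 42 * Hh + 32 * (2 * Hh) else 106 * Hh) := by
  rcases j with _ | _ | _ | _ | _ | _ | _ | _ | j
  all_goals first | omega | (simp [bH, sOdd]; try ring)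

/-- THE POTENTIAL AT `(M + t)·u_j` FOR `0 ≤ t ≤ M` (integer `t`, `H = 2^(m-1)`), top case included.
[gemm.tex Thm t:thetap (ii)] -/
theorem psiZp_vertex' {m : ℕ} (hm : 1 ≤ m) {H : ℤ} (hM : (2 : ℤ) ^ m = 2 * H) {j : ℕ} (hj : j ≤ 8)
    {t : ℤ} (ht0 : 0 ≤ t) (ht : t ≤ 2 * H) (htop : j = 8 → t = 0) :
    psiZp m ((2 * H + t) * 2 ^ (j + 1)) =
      if j ≤ 6 then bH j * H + sOdd j * ((t + 1) / 2)
      else if j = 7 then 42 * H + 32 * t else 106 * H := by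
  have hHm : (2 : ℤ) ^ (m - 1) = H := by
    have : (2 : ℤ) ^ m = 2 * 2 ^ (m - 1) := by
      rw [← pow_succ']; congr 1; omega
    linarith
  rcases lt_or_eq_of_le ht with hlt | rfl
  · -- interior vertex
    have htn : ((t.toNat : ℕ) : ℤ) = t := Int.toNat_of_nonneg ht0
    have htn' : t.toNat < 2 ^ m := by
      have : ((t.toNat : ℕ) : ℤ) < ((2 ^ m : ℕ) : ℤ) := by push_cast; rw [htn, hM]; exact hlt
      exact_mod_cast this
    have hv : (2 * H + t) * 2 ^ (j + 1) = (((2 ^ m + t.toNat) * 2 ^ (j + 1) : ℕ) : ℤ) := by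
      push_cast; rw [htn, hM]
    rw [hv, psiZp_vertex htn', hHm]
    have hc : ((((t.toNat + 1) / 2 : ℕ)) : ℤ) = (t + 1) / 2 := by
      rw [Int.natCast_div]; push_cast; rw [htn]
    rw [hc, htn]
  · -- `t = M`: the first vertex of binade `j + 1`
    have hj7 : j ≤ 7 := by
      by_contra h
      have := htop (by omega)
      have : (0 : ℤ) < 2 * H := by rw [← hM]; positivity
      omega
    have hv : (2 * H + 2 * H) * (2 : ℤ) ^ (j + 1) = (((2 ^ m + 0) * 2 ^ ((j + 1) + 1) : ℕ) : ℤ) := by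
      push_cast; rw [hM]; ring
    rw [hv, psiZp_vertex (by positivity), hHm, psi_glue j hj7 H]
    have h2 : (2 * H + 1) / 2 = H := by omega
    rw [h2]

/-! ### Agreement of the symbolic potential forms with `psiZp` -/

/-- SOUNDNESS OF `psiBig`: at every parameter of the domain the form is the potential of the vertex
`(M + t')·u_j`, and `0 ≤ t' ≤ M`. [cell] -/
theorem psiBig_sound {m : ℕ} (hm : 1 ≤ m) {H T : ℤ} (hM : (2 : ℤ) ^ m = 2 * H) {hasT : Bool}
    (hd : Dom hasT H T) {j : ℕ} {tf f : AForm} (h : psiBig hasT j tf = some f) :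
    0 ≤ tf.eval H T ∧ tf.eval H T ≤ 2 * H ∧ j ≤ 8 ∧
      f.eval H T = psiZp m ((2 * H + tf.eval H T) * 2 ^ (j + 1)) := by
  unfold psiBig at h
  by_cases hc : (nonnegOn hasT tf && nonnegOn hasT ((AForm.hH 2).sub tf)) = true
  · rw [if_pos hc] at h
    rw [Bool.and_eq_true] at hc
    have h0 := nonnegOn_sound hc.1 hd
    have h1 := nonnegOn_sound hc.2 hd
    simp only [AForm.eval_sub, AForm.eval_hH] at h1
    have ht2 : tf.eval H T ≤ 2 * H := by linarith
    refine ⟨h0, ht2, ?_⟩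
    by_cases hj6 : j ≤ 6
    · rw [if_pos hj6] at h
      obtain ⟨ch, hch, rfl⟩ := Option.map_eq_some_iff.mp h
      refine ⟨by omega, ?_⟩
      rw [psiZp_vertex' hm hM (by omega) h0 ht2 (by omega), if_pos hj6]
      simp only [AForm.eval_add, AForm.eval_smul, AForm.eval_hH, ceilHalf_sound hch]
      ring
    · rw [if_neg hj6] at h
      by_cases hj7 : j = 7
      · rw [if_pos hj7] at h
        simp only [Option.some.injEq] at h
        subst h; subst hj7
        refine ⟨by omega, ?_⟩
        rw [psiZp_vertex' hm hM (by omega) h0 ht2 (by omega)]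
        simp only [AForm.eval_add, AForm.eval_smul, AForm.eval_hH]
        norm_num
        try ring
      · rw [if_neg hj7] at h
        by_cases hj8 : j = 8
        · rw [if_pos hj8] at h
          obtain ⟨hz, h⟩ := Option.ite_none_right_eq_some.mp h
          simp only [Option.some.injEq] at h
          subst h; subst hj8
          have hz' := nonnegOn_sound hz hd
          simp only [AForm.eval_sub, AForm.eval_const] at hz'
          have ht0 : tf.eval H T = 0 := by linarith
          refine ⟨le_rfl, ?_⟩
          rw [psiZp_vertex' hm hM le_rfl h0 ht2 (fun _ => ht0)]
          simp [AForm.eval_hH]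
        · rw [if_neg hj8] at h; exact absurd h (by simp)
  · rw [if_neg hc] at h; exact absurd h (by simp)

/-- SOUNDNESS OF `psiTgt` on a binade target: the form is `ψ` of the target value. [cell] -/
theorem psiTgt_big_sound {m : ℕ} (hm : 1 ≤ m) {H T : ℤ} (hM : (2 : ℤ) ^ m = 2 * H) {hasT : Bool}
    (hd : Dom hasT H T) {e : ℕ} {sig f : AForm} (h : psiTgt hasT (Tgt.big e sig) = some f) :
    f.eval H T = psiZp m (sig.eval H T * 2 ^ e) := by
  simp only [psiTgt] at h
  by_cases he : e = 0
  · rw [if_pos he] at h; exact absurd h (by simp)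
  · rw [if_neg he] at h
    obtain ⟨-, -, -, h4⟩ := psiBig_sound hm hM hd h
    rw [h4]
    simp only [AForm.eval_sub, AForm.eval_hH]
    congr 1
    rw [show e - 1 + 1 = e by omega]; ring

/-! ### Validity, values and potentials of the classes -/

/-- The admissible index ranges of the classes. [cell] -/
def Cls.valid : Cls → Prop
  | Cls.qh z => 1 ≤ z ∧ z ≤ 144
  | Cls.low j t => (j ≤ 7 ∧ t ≤ 71) ∨ (j = 8 ∧ t = 0)
  | Cls.mid j π => j ≤ 7 ∧ π ≤ 1
  | Cls.high j s => j ≤ 7 ∧ 1 ≤ s ∧ s ≤ 72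

/-- SOUNDNESS OF THE CLASS POTENTIAL: `Cls.psiF` evaluates to `ψ` of the class value, which is
nonnegative (indeed `≥ 4H - 144`). [cell] -/
theorem psiF_sound {m : ℕ} (hm : 1 ≤ m) {H T : ℤ} (hM : (2 : ℤ) ^ m = 2 * H) (hH128 : 128 ≤ H)
    {c : Cls} (hc : c.valid) (hd : Dom c.hasT H T) {f : AForm} (h : c.psiF = some f) :
    4 * H - 144 ≤ c.valF.eval H T ∧ f.eval H T = psiZp m (c.valF.eval H T) := by
  cases c with
  | qh z =>
    simp only [Cls.valid] at hc
    simp only [Cls.psiF, Option.some.injEq] at h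
    subst h
    simp only [Cls.valF, AForm.eval_mk]
    refine ⟨by omega, ?_⟩
    rw [psiZp_of_small m (by omega) (by rw [pow_succ, hM]; omega)]
  | low j t =>
    simp only [Cls.psiF] at h
    obtain ⟨h0, h2, hj, h4⟩ := psiBig_sound hm hM hd h
    simp only [AForm.eval_const] at h0 h2 h4
    have hv : (Cls.low j t).valF.eval H T = (2 * H + t) * 2 ^ (j + 1) := by
      simp only [Cls.valF, u, AForm.eval_mk]; ring
    rw [hv, h4]
    refine ⟨?_, rfl⟩
    have : (2 : ℤ) ≤ 2 ^ (j + 1) := by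
      calc (2 : ℤ) = 2 ^ 1 := by norm_num
        _ ≤ 2 ^ (j + 1) := pow_le_pow_right₀ (by norm_num) (by omega)
    nlinarith
  | mid j π =>
    simp only [Cls.psiF] at h
    obtain ⟨h0, h2, hj, h4⟩ := psiBig_sound hm hM hd h
    simp only [AForm.eval_mk] at h0 h2 h4
    have hv : (Cls.mid j π).valF.eval H T = (2 * H + ((π : ℤ) + 0 * H + 2 * T)) * 2 ^ (j + 1) := by
      simp only [Cls.valF, u, AForm.eval_mk]; ring
    rw [hv, h4]
    refine ⟨?_, rfl⟩
    have : (2 : ℤ) ≤ 2 ^ (j + 1) := by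
      calc (2 : ℤ) = 2 ^ 1 := by norm_num
        _ ≤ 2 ^ (j + 1) := pow_le_pow_right₀ (by norm_num) (by omega)
    nlinarith
  | high j s =>
    simp only [Cls.psiF] at h
    obtain ⟨h0, h2, hj, h4⟩ := psiBig_sound hm hM hd h
    simp only [AForm.eval_mk] at h0 h2 h4
    have hv : (Cls.high j s).valF.eval H T = (2 * H + (-(s : ℤ) + 2 * H + 0 * T)) * 2 ^ (j + 1) := by
      simp only [Cls.valF, u, AForm.eval_mk]; ring
    rw [hv, h4]
    refine ⟨?_, rfl⟩
    have : (2 : ℤ) ≤ 2 ^ (j + 1) := by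
      calc (2 : ℤ) = 2 ^ 1 := by norm_num
        _ ≤ 2 ^ (j + 1) := pow_le_pow_right₀ (by norm_num) (by omega)
    nlinarith

/-! ### Coverage of the states of magnitude `≥ 2^p` by classes -/

/-- COVERAGE: every state magnitude `(M + t)·u_j` (`j ≤ 7`, `t ≤ M`) is the value of a valid class
at admissible parameters: `low` (`t ≤ 71`), `mid` (`72 ≤ t ≤ M - 73`, `T = ⌊t/2⌋`), `high`
(`t ≥ M - 72`), or the first vertex of the next binade (`t = M`). [cell] -/
theorem cover {m : ℕ} {H : ℤ} (hM : (2 : ℤ) ^ m = 2 * H) (hH128 : 128 ≤ H) {j t : ℕ} (hj : j ≤ 7)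
    (ht : t ≤ 2 ^ m) :
    ∃ c : Cls, ∃ T : ℤ, c.valid ∧ Dom c.hasT H T ∧
      c.valF.eval H T = (((2 ^ m + t) * 2 ^ (j + 1) : ℕ) : ℤ) := by
  have htZ : ((t : ℕ) : ℤ) ≤ 2 * H := by rw [← hM]; exact_mod_cast ht
  by_cases h1 : t ≤ 71
  · refine ⟨Cls.low j t, 0, Or.inl ⟨hj, h1⟩, ⟨hH128, by simp [Cls.hasT], fun _ => rfl⟩, ?_⟩
    simp only [Cls.valF, u, AForm.eval_mk]; push_cast; rw [hM]; ring
  by_cases h2 : ((t : ℕ) : ℤ) ≤ 2 * H - 73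
  · refine ⟨Cls.mid j (t % 2), (t : ℤ) / 2, ⟨hj, by omega⟩,
      ⟨hH128, fun _ => ⟨by omega, by omega⟩, by simp [Cls.hasT]⟩, ?_⟩
    simp only [Cls.valF, u, AForm.eval_mk]; push_cast; rw [hM]
    have : ((t % 2 : ℕ) : ℤ) + 2 * ((t : ℤ) / 2) = t := by omega
    calc ((t % 2 : ℕ) : ℤ) * 2 ^ (j + 1) + 2 * 2 ^ (j + 1) * H + 2 * 2 ^ (j + 1) * ((t : ℤ) / 2)
        = (2 * H + (((t % 2 : ℕ) : ℤ) + 2 * ((t : ℤ) / 2))) * 2 ^ (j + 1) := by ring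
      _ = (2 * H + t) * 2 ^ (j + 1) := by rw [this]
  by_cases h3 : ((t : ℕ) : ℤ) < 2 * H
  · refine ⟨Cls.high j (2 * H - t).toNat, 0, ⟨hj, by omega, by omega⟩,
      ⟨hH128, by simp [Cls.hasT], fun _ => rfl⟩, ?_⟩
    simp only [Cls.valF, u, AForm.eval_mk]; push_cast; rw [hM, Int.toNat_of_nonneg (by omega)]; ring
  · have hte : ((t : ℕ) : ℤ) = 2 * H := le_antisymm htZ (not_lt.mp h3)
    by_cases hj6 : j ≤ 6
    · refine ⟨Cls.low (j + 1) 0, 0, Or.inl ⟨by omega, by omega⟩,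
        ⟨hH128, by simp [Cls.hasT], fun _ => rfl⟩, ?_⟩
      simp only [Cls.valF, u, AForm.eval_mk]; push_cast; rw [hM, hte]; ring
    · have hj7 : j = 7 := by omega
      subst hj7
      refine ⟨Cls.low 8 0, 0, Or.inr ⟨rfl, rfl⟩, ⟨hH128, by simp [Cls.hasT], fun _ => rfl⟩, ?_⟩
      simp only [Cls.valF, u, AForm.eval_mk]; push_cast; rw [hM, hte]; ring

/-- COVERAGE NEAR THE TOP OF THE EXACT REGION: a magnitude `4H - z`, `1 ≤ z ≤ 144`, is the class
`qh z`. [cell] -/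
theorem cover_qh {H : ℤ} (hH128 : 128 ≤ H) {z : ℕ} (hz1 : 1 ≤ z) (hz : z ≤ 144) :
    (Cls.qh z).valid ∧ Dom (Cls.qh z).hasT H 0 ∧ (Cls.qh z).valF.eval H 0 = 4 * H - z :=
  ⟨⟨hz1, hz⟩, ⟨hH128, by simp [Cls.hasT], fun _ => rfl⟩, by simp only [Cls.valF, AForm.eval_mk]; ring⟩

/-- COVERAGE OF THE EVEN VERTICES of binade `j' ≤ 6` by the pair-table classes `succList j'`.
[cell] -/
theorem cover_even {m : ℕ} {H : ℤ} (hM : (2 : ℤ) ^ m = 2 * H) (hH128 : 128 ≤ H) {jp : ℕ}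
    {t : ℤ} (ht0 : 0 ≤ t) (ht : t ≤ 2 * H) (hev : 2 ∣ t) :
    ∃ c ∈ succList jp, ∃ T : ℤ, Dom c.hasT H T ∧ c.valF.eval H T = (2 * H + t) * 2 ^ (jp + 1) := by
  obtain ⟨k, rfl⟩ := hev
  by_cases h1 : k ≤ 35
  · refine ⟨Cls.low jp (2 * k.toNat), ?_, 0, ⟨hH128, by simp [Cls.hasT], fun _ => rfl⟩, ?_⟩
    · simp only [succList, List.mem_append, List.mem_map, List.mem_range, List.mem_singleton]
      exact Or.inl (Or.inl (Or.inl ⟨k.toNat, by omega, rfl⟩))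
    · simp only [Cls.valF, u, AForm.eval_mk]; push_cast; rw [Int.toNat_of_nonneg (by omega)]; ring
  by_cases h2 : k ≤ H - 37
  · refine ⟨Cls.mid jp 0, ?_, k, ⟨hH128, fun _ => ⟨by omega, h2⟩, by simp [Cls.hasT]⟩, ?_⟩
    · simp [succList]
    · simp only [Cls.valF, u, AForm.eval_mk]; push_cast; ring
  by_cases h3 : k < H
  · refine ⟨Cls.high jp (2 * (H - k - 1).toNat + 2), ?_, 0,
      ⟨hH128, by simp [Cls.hasT], fun _ => rfl⟩, ?_⟩
    · simp only [succList, List.mem_append, List.mem_map, List.mem_range, List.mem_singleton]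
      exact Or.inl (Or.inr ⟨(H - k - 1).toNat, by omega, rfl⟩)
    · simp only [Cls.valF, u, AForm.eval_mk]; push_cast; rw [Int.toNat_of_nonneg (by omega)]; ring
  · have hk : k = H := by omega
    subst hk
    refine ⟨Cls.low (jp + 1) 0, by simp [succList], 0, ⟨hH128, by simp [Cls.hasT], fun _ => rfl⟩, ?_⟩
    simp only [Cls.valF, u, AForm.eval_mk]; push_cast; ring

end ThetaLawE2M1

end MiniFloat

end Literature.ComputerArithmetic.FloatingPoint
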